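import Summits.CriticalPhenomena.Ising3D.Control2DRecord
import Summits.CriticalPhenomena.Ising3D.Control2DIsingSpectrum
import Mathlib.Tactic.NormNum
import HarnessLib

/-!
# The 2D control's record evaluated ON the 2D Ising datum (one import for a referee)
(cell `pub-ising3x`, seat controls-1 gen 37; CONTROL-ONLY)

HONEST FRAMING: lottery ticket; floor = tightest certified 3D Ising CFT bounds; no exact-solution
claim without a proof. CONTROL-ONLY (`d = 2`, `Δ_σ = 1/8`); nothing new is proved here beyond APPLICATIONS
of the theorems of record (`Control2DRecord`: the certified exclusions, all modulo nothing) to the kernel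
datum `isingData2D` (`Control2DIsingData`/`Control2DIsingSpectrum`: `⟨σσσσ⟩` of the 2D Ising CFT, unitary,
crossing-symmetric at `Δ_σ = 1/8`, `A2D′ (2,1)` with `Δ_ε = 1`, `p_T = 1/64`, `p_ε = 1/8`).

Each conjunct below is an INEQUALITY BETWEEN RATIONALS that is obtained NOT by evaluating it but by
instantiating a certified exclusion theorem at the Ising datum — the kernel form of "the blind 2D control
recognises Onsager/BPZ": were any certificate of record wrong, one of these instantiations would be a proof
of `False`.

* `record_twoSided_at_ising`  : `99/100 < 1 ∧ 1 < 20001/20000` from `twoSided_2d_kernel099` (Λ = 19);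
* `record_c_at_ising`         : `78125/156258 < 1/2 ∧ 1/2 < 125/248` from `cTwoSided_2d_L19`;
* `record_pbox_at_ising`      : `2^{197/200}·15621/250000 < 1/8 ∧ 1/8 < 2^{20001/20000}·319051/5000000`
  from `pBoxTwoSided_2d_L15`;
* `record_gapThreshold_window_one` : `¬ GapExcluded (1/8) 1 ∧ GapExcluded (1/8) (20001/20000)` — the
  threshold of the typed one-sided item is now pinned to `(1, 1.00005]` (was `(1/2, 1.00005]`);
* `control2D_record_ising` : the conjunction, plus the inhabited class.

References: A. A. Belavin, A. M. Polyakov, A. B. Zamolodchikov, Nucl. Phys. B 241 (1984) 333, §5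
[cite: BelavinPolyakovZamolodchikov1984, §5]; R. Rattazzi, V. S. Rychkov, E. Tonni, A. Vichi, JHEP 12 (2008)
031, §5 [cite: RattazziEtAl2008, §5].
-/

namespace Summit.CriticalPhenomena.Ising3D.Control2D

open Set

/-- **The `Λ = 19` class-1 rung at the Ising datum**: `99/100 < Δ_ε = 1 < 20001/20000`, obtained by
instantiating `twoSided_2d_kernel099` (window `w = 1`). [cite: RattazziEtAl2008, §5] -/
theorem record_twoSided_at_ising : (99 / 100 : ℝ) < 1 ∧ (1 : ℝ) < 20001 / 20000 :=
  twoSided_ising (record_twoSided.2.2.2.2.2 1) le_rfl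

/-- **The `Λ = 19` central-charge rung at the Ising datum**: `78125/156258 < c = 1/2 < 125/248`, by
instantiating `cTwoSided_2d_L19` (reduced-fraction form) at the datum (`ε` box `[49/50, 20001/20000] ∋ 1`).
[cite: RattazziEtAl2008, §5] -/
theorem record_c_at_ising : (78125 / 156258 : ℝ) < 1 / 2 ∧ (1 / 2 : ℝ) < 125 / 248 :=
  cTwoSided_ising record_centralCharge_fractions.2.2 (by norm_num) (by norm_num)

/-- **The `Λ = 15` in-box OPE rung at the Ising datum**: `2^{197/200}·15621/250000 < p_ε = 1/8 <
2^{20001/20000}·319051/5000000` (`λ²_{σσε} = 1/4`), by instantiating `pBoxTwoSided_2d_L15`.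
[cite: RattazziEtAl2008, §5] -/
theorem record_pbox_at_ising :
    (2 : ℝ) ^ (197 / 200 : ℝ) * (15621 / 250000) < 1 / 8 ∧
      (1 / 8 : ℝ) < (2 : ℝ) ^ (20001 / 20000 : ℝ) * (319051 / 5000000) :=
  pBoxTwoSided_ising record_ope.2 (by norm_num) (by norm_num) (by norm_num)

/-- **The one-sided threshold window, pinned**: `¬ GapExcluded (1/8) 1` (Ising datum: all scalars `Δ ≥ 1`)
and `GapExcluded (1/8) (20001/20000)` (`Λ = 19` certificate): the threshold lies in `(1, 1.00005]`.
[cite: RattazziEtAl2008, §5] -/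
theorem record_gapThreshold_window_one :
    ¬ GapExcluded (1 / 8 : ℝ) 1 ∧ GapExcluded (1 / 8 : ℝ) (20001 / 20000) :=
  ⟨fun h => lt_irrefl (1 : ℝ) (gapExcluded_ising h), record_oneSided.2.2.2.2.2⟩

/-- The two rays: `U ≤ 1 ⇒ ¬ GapExcluded (1/8) U`; `U ≥ 20001/20000 ⇒ GapExcluded (1/8) U`. [folklore] -/
theorem record_gapThreshold_rays_one (U : ℝ) :
    (U ≤ 1 → ¬ GapExcluded (1 / 8 : ℝ) U) ∧ (20001 / 20000 ≤ U → GapExcluded (1 / 8 : ℝ) U) :=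
  ⟨fun hU h => not_le.mpr (gapExcluded_ising h) hU, fun hU => record_oneSided.2.2.2.2.2.mono hU⟩

/-- **Record ∧ Ising witness in one theorem**: the `A2D′ (2,1)` class at `Δ_σ = 1/8` is inhabited by a datum
with `Δ_ε = 1`, `p_T = (1/8)²/(2·(1/2))`, `p_ε = 1/8`; and the `Λ = 19` / `Λ = 15` rungs of record hold AND
contain these values. [folklore] -/
theorem control2D_record_ising :
    (∃ D : CrossingData, D.IsUnitary ∧ D.SatisfiesCrossing (1 / 8 : ℝ) ∧ D.ScalarsIn ({1} ∪ Ici 2) ∧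
        D.SpinTwoIn ({2} ∪ Ici (2 + 1)) ∧ D.stressCoeff = 1 / 64) ∧
    (∀ w : ℝ, TwoSided (1 / 8 : ℝ) 2 1 w (99 / 100) (20001 / 20000)) ∧
    ((99 / 100 : ℝ) < 1 ∧ (1 : ℝ) < 20001 / 20000) ∧
    ((78125 / 156258 : ℝ) < 1 / 2 ∧ (1 / 2 : ℝ) < 125 / 248) ∧
    ((2 : ℝ) ^ (197 / 200 : ℝ) * (15621 / 250000) < 1 / 8 ∧
      (1 / 8 : ℝ) < (2 : ℝ) ^ (20001 / 20000 : ℝ) * (319051 / 5000000)) :=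
  ⟨a2d_class_nonvacuous_eighth, record_twoSided.2.2.2.2.2, record_twoSided_at_ising, record_c_at_ising,
    record_pbox_at_ising⟩

/-! ### Appendix (controls-1 gen 39, same day): the data-set TYPE at the datum; the allowed set and the
optimal one-sided bound as named reals

Three readings of the record that the paper states in prose, as closed kernel statements (CONTROL-ONLY, `d = 2`,
`Δ_σ = 1/8`; nothing numerical enters beyond the theorems of record and the Ising datum):

* `controlDataSet_ising` — the three-datum TYPE `ControlDataSet (1/8) 2 1 w …` can never exclude the Onsager–BPZ
  values, WHATEVER its ten parameters: any instance with window `w ≤ 1` (and `ε_hi < 4`, so that the box coefficient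
  is `p_ε` alone) has `ε_lo < 1 < ε_hi`, `c_lo < 1/2 < c_hi`, `p_lo < 1/8 < p_hi` — by instantiation at `isingData2D`
  (`c = 1/2` enters through `stressCoeff = (1/8)²/(2·½)`); at the instance of record (`controlDataSet_kernel099 1`)
  it yields `controlDataSet_kernel099_truth_inside` by instantiation instead of `norm_num`;
* `forall_twoSided_iff_subset` / `allowedLocations_eighth` — the class-1 item for every window IS the statement that
  the set of NON-excluded `ε` locations `{x | ¬ ExcludedAt s G δ x}` lies in the open interval; at the column:
  `1 ∈ {x | ¬ ExcludedAt (1/8) 2 1 x} ⊆ (99/100, 20001/20000)`, hence its infimum and supremum — the edges of the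
  `Λ → ∞` column island under `A2D′ (2,1)` — satisfy `99/100 ≤ inf ≤ 1 ≤ sup ≤ 20001/20000`
  (`allowedLocations_eighth_bounds`). That the set IS `{1}` is NOT claimed (the open uniqueness question);
* `gapThreshold_eighth` — the optimal one-sided bound `U⋆ := sInf {U | GapExcluded (1/8) U}` is a real number in
  `[1, 20001/20000]`; every `U > U⋆` is excluded (the excluded gaps form an upper ray, `GapExcluded.mono`) and no
  `U ≤ 1` is (Ising datum). Whether `U⋆ = 1`, and whether `U⋆` itself is excluded, is NOT claimed.
-/

/-- **The data-set type at the Ising datum.** For EVERY parameter set: if `ControlDataSet (1/8) 2 1 w ε_lo ε_hi c_lo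
c_hi p_lo p_hi` holds with window `w ≤ 1` and `ε_hi < 4`, then `ε_lo < 1 < ε_hi`, `c_lo < 1/2 < c_hi` and
`p_lo < 1/8 < p_hi` — instantiate at `isingData2D` (location `x = 1`, `A2D′ (2,1)`, `stressCoeff = 1/64 = (1/8)²/(2·½)`,
`boxCoeff ε_lo ε_hi = 1/8` once `1 ∈ [ε_lo, ε_hi]` and `ε_hi < 4`). A certified data set of this type that missed one of
the three exact values would be a proof of `False`. CONTROL-ONLY (d = 2). [cite: BelavinPolyakovZamolodchikov1984, App. E] -/
theorem controlDataSet_ising {w εlo εhi clo chi plo phi : ℝ}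
    (h : ControlDataSet (1 / 8) 2 1 w εlo εhi clo chi plo phi) (hw : w ≤ 1) (h₄ : εhi < 4) :
    (εlo < 1 ∧ 1 < εhi) ∧ (clo < 1 / 2 ∧ 1 / 2 < chi) ∧ (plo < 1 / 8 ∧ 1 / 8 < phi) := by
  obtain ⟨hε, hc, hp⟩ :=
    h isingData2D isingData2D_isUnitary isingData2D_satisfiesCrossing isingData2D_A2D.2 1 hw isingData2D_A2D.1
  refine ⟨hε, hc (1 / 2) (by norm_num) (by rw [isingData2D_stressCoeff]; norm_num), ?_⟩
  rwa [isingData2D_boxCoeff hε.1.le hε.2.le h₄] at hp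

/-- **Class 1 for every window = the allowed set lies in the interval.** For any column `s` and `A2D′ (G, δ)`:
`(∀ w, TwoSided s G δ w lo hi) ↔ {x | ¬ ExcludedAt s G δ x} ⊆ (lo, hi)` — the set of `ε` locations NOT excluded
(those carried by at least one admissible datum) is contained in the open interval. Pure logic. [folklore] -/
theorem forall_twoSided_iff_subset {s G δ lo hi : ℝ} :
    (∀ w : ℝ, TwoSided s G δ w lo hi) ↔ {x : ℝ | ¬ ExcludedAt s G δ x} ⊆ Ioo lo hi := by
  constructor
  · intro h x hx
    by_contra hnot
    exact hx fun D hU hC hS hT => hnot (h x D hU hC hT x le_rfl hS)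
  · intro h w D hU hC hT x _ hS
    exact h fun hex => hex D hU hC hS hT

/-- **The allowed `ε` locations at the column `Δ_σ = 1/8` under `A2D′ (2,1)`**: the set `{x | ¬ ExcludedAt (1/8) 2 1 x}`
CONTAINS `1` (the Ising datum, `not_excludedAt_ising_one`) and is CONTAINED in `(99/100, 20001/20000)` (the `Λ = 19`
class-1 rung for every window, `twoSided_2d_kernel099`). Equality with `{1}` is not claimed. [cite: RattazziEtAl2008, §5] -/
theorem allowedLocations_eighth :
    (1 : ℝ) ∈ {x : ℝ | ¬ ExcludedAt (1 / 8) 2 1 x} ∧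
      {x : ℝ | ¬ ExcludedAt (1 / 8) 2 1 x} ⊆ Ioo (99 / 100) (20001 / 20000) :=
  ⟨not_excludedAt_ising_one, forall_twoSided_iff_subset.mp twoSided_2d_kernel099⟩

/-- **The edges of the `Λ → ∞` column island as real numbers**: with `A = {x | ¬ ExcludedAt (1/8) 2 1 x}` (non-empty,
bounded), `99/100 ≤ sInf A ≤ 1 ≤ sSup A ≤ 20001/20000`. Elementary order theory on `allowedLocations_eighth`. [folklore] -/
theorem allowedLocations_eighth_bounds :
    (99 / 100 : ℝ) ≤ sInf {x : ℝ | ¬ ExcludedAt (1 / 8) 2 1 x} ∧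
      sInf {x : ℝ | ¬ ExcludedAt (1 / 8) 2 1 x} ≤ 1 ∧
        (1 : ℝ) ≤ sSup {x : ℝ | ¬ ExcludedAt (1 / 8) 2 1 x} ∧
          sSup {x : ℝ | ¬ ExcludedAt (1 / 8) 2 1 x} ≤ 20001 / 20000 := by
  obtain ⟨h1, hsub⟩ := allowedLocations_eighth
  have hne : ({x : ℝ | ¬ ExcludedAt (1 / 8) 2 1 x}).Nonempty := ⟨1, h1⟩
  have hbb : BddBelow {x : ℝ | ¬ ExcludedAt (1 / 8) 2 1 x} := ⟨99 / 100, fun x hx => (hsub hx).1.le⟩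
  have hba : BddAbove {x : ℝ | ¬ ExcludedAt (1 / 8) 2 1 x} := ⟨20001 / 20000, fun x hx => (hsub hx).2.le⟩
  exact ⟨le_csInf hne fun x hx => (hsub hx).1.le, csInf_le hbb h1, le_csSup hba h1,
    csSup_le hne fun x hx => (hsub hx).2.le⟩

/-- **Above the infimum of the excluded gaps, every gap is excluded** (any column `s`): the excluded gaps form an upper
ray by `GapExcluded.mono`, so `sInf {U | GapExcluded s U} < U ⇒ GapExcluded s U` once the set is non-empty. [folklore] -/
theorem gapExcluded_of_sInf_lt {s U : ℝ} (hne : ({U : ℝ | GapExcluded s U}).Nonempty)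
    (hU : sInf {U : ℝ | GapExcluded s U} < U) : GapExcluded s U := by
  obtain ⟨U₀, hU₀, hlt⟩ := exists_lt_of_csInf_lt hne hU
  exact GapExcluded.mono hU₀ hlt.le

/-- **The optimal one-sided bound at `Δ_σ = 1/8` as ONE real number.** `U⋆ := sInf {U | GapExcluded (1/8) U}` satisfies
`1 ≤ U⋆ ≤ 20001/20000` (every excluded gap exceeds `1` by the Ising datum, `gapExcluded_ising`; `20001/20000` is excluded,
`Λ = 19`); every `U > U⋆` is excluded; no `U ≤ 1` is excluded. `U⋆ = 1` is NOT claimed. CONTROL-ONLY (d = 2).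
[cite: RattazziEtAl2008, §5] -/
theorem gapThreshold_eighth :
    sInf {U : ℝ | GapExcluded (1 / 8) U} ∈ Icc (1 : ℝ) (20001 / 20000) ∧
      (∀ U : ℝ, sInf {U : ℝ | GapExcluded (1 / 8) U} < U → GapExcluded (1 / 8) U) ∧
        (∀ U : ℝ, U ≤ 1 → ¬ GapExcluded (1 / 8) U) := by
  have hmem : (20001 / 20000 : ℝ) ∈ {U : ℝ | GapExcluded (1 / 8) U} := record_oneSided.2.2.2.2.2
  have hne : ({U : ℝ | GapExcluded (1 / 8) U}).Nonempty := ⟨_, hmem⟩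
  have hlow : ∀ U ∈ {U : ℝ | GapExcluded (1 / 8) U}, (1 : ℝ) ≤ U := fun U hU => (gapExcluded_ising hU).le
  have hbb : BddBelow {U : ℝ | GapExcluded (1 / 8) U} := ⟨1, hlow⟩
  exact ⟨⟨le_csInf hne hlow, csInf_le hbb hmem⟩, fun U hU => gapExcluded_of_sInf_lt hne hU,
    fun U hU => (record_gapThreshold_rays_one U).1 hU⟩

/-! ### Appendix (controls-1 gen 39, second part): the `c` and `λ²` rows in the same set language

The two remaining data of the record read as statements about SETS OF REALS carried by admissible data (CONTROL-ONLY,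
`d = 2`, `Δ_σ = 1/8`, `A2D′ (2,1)` with the `ε` box as scalar input, exactly the hypotheses of `CTwoSided` /
`PBoxTwoSided`): the set of Ward central charges `c > 0` realised by a datum with sub-gap scalars in the box
`[49/50, 20001/20000]` contains `1/2` (Ising datum) and lies in `(78125/156258, 125/248)` (`Λ = 19`); the set of total
in-box scalar coefficients `p_box` on the box `[197/200, 20001/20000]` contains `1/8` and lies in
`(123674/10⁶, 127625/10⁶)` (`Λ = 15`, decimal form). `cTwoSided_iff_subset` / `pBoxTwoSided_iff_subset` are the
pure-logic identifications; nothing is claimed about these sets being singletons.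
-/

/-- **`c` two-sided = the set of realised Ward central charges lies in the interval** (any column, any box):
`CTwoSided s G δ e₁ e₂ c_lo c_hi ↔ {c | 0 < c ∧ ∃ admissible D with stressCoeff = s²/(2c)} ⊆ (c_lo, c_hi)`. Pure logic.
[folklore] -/
theorem cTwoSided_iff_subset {s G δ e₁ e₂ clo chi : ℝ} :
    CTwoSided s G δ e₁ e₂ clo chi ↔
      {c : ℝ | 0 < c ∧ ∃ D : CrossingData, D.IsUnitary ∧ D.SatisfiesCrossing s ∧
          D.ScalarsIn (Icc e₁ e₂ ∪ Ici G) ∧ D.SpinTwoIn ({2} ∪ Ici (2 + δ)) ∧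
            D.stressCoeff = s ^ 2 / (2 * c)} ⊆ Ioo clo chi := by
  constructor
  · rintro h c ⟨hc, D, hU, hC, hS, hT, hW⟩
    exact h D hU hC hS hT c hc hW
  · intro h D hU hC hS hT c hc hW
    exact h ⟨hc, D, hU, hC, hS, hT, hW⟩

/-- **The realised central charges at the column** (`ε` box `[49/50, 20001/20000]`, Ward normalisation): the set
`{c > 0 | some A2D′ (2,1) datum at Δ_σ = 1/8 with sub-gap scalars in the box has total (2,2) coefficient (1/8)²/(2c)}`
CONTAINS `1/2` (the Ising datum: `stressCoeff = 1/64`) and is CONTAINED in `(78125/156258, 125/248)` (`cTwoSided_2d_L19`,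
reduced fractions). CONTROL-ONLY (d = 2). [cite: BelavinPolyakovZamolodchikov1984, §5] -/
theorem allowedCentralCharges_eighth :
    (1 / 2 : ℝ) ∈ {c : ℝ | 0 < c ∧ ∃ D : CrossingData, D.IsUnitary ∧ D.SatisfiesCrossing (1 / 8) ∧
        D.ScalarsIn (Icc (49 / 50) (20001 / 20000) ∪ Ici 2) ∧ D.SpinTwoIn ({2} ∪ Ici (2 + 1)) ∧
          D.stressCoeff = (1 / 8 : ℝ) ^ 2 / (2 * c)} ∧
      {c : ℝ | 0 < c ∧ ∃ D : CrossingData, D.IsUnitary ∧ D.SatisfiesCrossing (1 / 8) ∧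
        D.ScalarsIn (Icc (49 / 50) (20001 / 20000) ∪ Ici 2) ∧ D.SpinTwoIn ({2} ∪ Ici (2 + 1)) ∧
          D.stressCoeff = (1 / 8 : ℝ) ^ 2 / (2 * c)} ⊆ Ioo (78125 / 156258) (125 / 248) :=
  ⟨⟨by norm_num, isingData2D, isingData2D_isUnitary, isingData2D_satisfiesCrossing,
      isingData2D_scalarsIn_box (by norm_num) (by norm_num), isingData2D_A2D.2,
      by rw [isingData2D_stressCoeff]; norm_num⟩,
    cTwoSided_iff_subset.mp record_centralCharge_fractions.2.2⟩

/-- **`p_box` two-sided = the set of realised in-box coefficients lies in the interval** (any column, any box):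
`PBoxTwoSided s G δ e₁ e₂ lo hi ↔ {D.boxCoeff e₁ e₂ | D admissible} ⊆ (lo, hi)`. Pure logic. [folklore] -/
theorem pBoxTwoSided_iff_subset {s G δ e₁ e₂ lo hi : ℝ} :
    PBoxTwoSided s G δ e₁ e₂ lo hi ↔
      {q : ℝ | ∃ D : CrossingData, D.IsUnitary ∧ D.SatisfiesCrossing s ∧
          D.ScalarsIn (Icc e₁ e₂ ∪ Ici G) ∧ D.SpinTwoIn ({2} ∪ Ici (2 + δ)) ∧ D.boxCoeff e₁ e₂ = q} ⊆
        Ioo lo hi := by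
  constructor
  · rintro h q ⟨D, hU, hC, hS, hT, rfl⟩
    exact h D hU hC hS hT
  · intro h D hU hC hS hT
    exact h ⟨D, hU, hC, hS, hT, rfl⟩

/-- **The realised in-box scalar coefficients at the column** (`ε` box `[197/200, 20001/20000]`; tree normalisation,
`λ²_{σσ[box]} = 2 p_box`): the set `{D.boxCoeff (197/200) (20001/20000) | D an A2D′ (2,1) datum at Δ_σ = 1/8 with sub-gap
scalars in the box}` CONTAINS `1/8` (the Ising datum, `isingData2D_boxCoeff`: `λ²_{σσε} = 1/4`) and is CONTAINED in
`(123674/10⁶, 127625/10⁶)` (`Λ = 15`, `record_ope_decimal`). CONTROL-ONLY (d = 2). [cite: BelavinPolyakovZamolodchikov1984, App. E] -/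
theorem allowedBoxCoeffs_eighth :
    (1 / 8 : ℝ) ∈ {q : ℝ | ∃ D : CrossingData, D.IsUnitary ∧ D.SatisfiesCrossing (1 / 8) ∧
        D.ScalarsIn (Icc (197 / 200) (20001 / 20000) ∪ Ici 2) ∧ D.SpinTwoIn ({2} ∪ Ici (2 + 1)) ∧
          D.boxCoeff (197 / 200) (20001 / 20000) = q} ∧
      {q : ℝ | ∃ D : CrossingData, D.IsUnitary ∧ D.SatisfiesCrossing (1 / 8) ∧
        D.ScalarsIn (Icc (197 / 200) (20001 / 20000) ∪ Ici 2) ∧ D.SpinTwoIn ({2} ∪ Ici (2 + 1)) ∧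
          D.boxCoeff (197 / 200) (20001 / 20000) = q} ⊆ Ioo (123674 / 1000000) (127625 / 1000000) :=
  ⟨⟨isingData2D, isingData2D_isUnitary, isingData2D_satisfiesCrossing,
      isingData2D_scalarsIn_box (by norm_num) (by norm_num), isingData2D_A2D.2,
      isingData2D_boxCoeff (by norm_num) (by norm_num) (by norm_num)⟩,
    pBoxTwoSided_iff_subset.mp record_ope_decimal.2⟩

/-- **Infimum / supremum form of the three rows** (elementary order theory): for a non-empty set `S ⊆ (lo, hi)`
containing `t`, `lo ≤ sInf S ≤ t ≤ sSup S ≤ hi`. Used for `A` (locations), the `c` set and the `p_box` set. [folklore] -/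
theorem sInf_sSup_sandwich {S : Set ℝ} {lo hi t : ℝ} (ht : t ∈ S) (hS : S ⊆ Ioo lo hi) :
    lo ≤ sInf S ∧ sInf S ≤ t ∧ t ≤ sSup S ∧ sSup S ≤ hi :=
  have hne : S.Nonempty := ⟨t, ht⟩
  have hbb : BddBelow S := ⟨lo, fun _ hx => (hS hx).1.le⟩
  have hba : BddAbove S := ⟨hi, fun _ hx => (hS hx).2.le⟩
  ⟨le_csInf hne fun _ hx => (hS hx).1.le, csInf_le hbb ht, le_csSup hba ht, csSup_le hne fun _ hx => (hS hx).2.le⟩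

/-- **The `c` row as reals**: with `C` the set of `allowedCentralCharges_eighth`,
`78125/156258 ≤ sInf C ≤ 1/2 ≤ sSup C ≤ 125/248`. [folklore] -/
theorem allowedCentralCharges_eighth_bounds :
    (78125 / 156258 : ℝ) ≤ sInf {c : ℝ | 0 < c ∧ ∃ D : CrossingData, D.IsUnitary ∧ D.SatisfiesCrossing (1 / 8) ∧
        D.ScalarsIn (Icc (49 / 50) (20001 / 20000) ∪ Ici 2) ∧ D.SpinTwoIn ({2} ∪ Ici (2 + 1)) ∧
          D.stressCoeff = (1 / 8 : ℝ) ^ 2 / (2 * c)} ∧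
      sInf {c : ℝ | 0 < c ∧ ∃ D : CrossingData, D.IsUnitary ∧ D.SatisfiesCrossing (1 / 8) ∧
        D.ScalarsIn (Icc (49 / 50) (20001 / 20000) ∪ Ici 2) ∧ D.SpinTwoIn ({2} ∪ Ici (2 + 1)) ∧
          D.stressCoeff = (1 / 8 : ℝ) ^ 2 / (2 * c)} ≤ 1 / 2 ∧
      (1 / 2 : ℝ) ≤ sSup {c : ℝ | 0 < c ∧ ∃ D : CrossingData, D.IsUnitary ∧ D.SatisfiesCrossing (1 / 8) ∧
        D.ScalarsIn (Icc (49 / 50) (20001 / 20000) ∪ Ici 2) ∧ D.SpinTwoIn ({2} ∪ Ici (2 + 1)) ∧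
          D.stressCoeff = (1 / 8 : ℝ) ^ 2 / (2 * c)} ∧
      sSup {c : ℝ | 0 < c ∧ ∃ D : CrossingData, D.IsUnitary ∧ D.SatisfiesCrossing (1 / 8) ∧
        D.ScalarsIn (Icc (49 / 50) (20001 / 20000) ∪ Ici 2) ∧ D.SpinTwoIn ({2} ∪ Ici (2 + 1)) ∧
          D.stressCoeff = (1 / 8 : ℝ) ^ 2 / (2 * c)} ≤ 125 / 248 :=
  sInf_sSup_sandwich allowedCentralCharges_eighth.1 allowedCentralCharges_eighth.2

/-- **The `p_box` row as reals**: with `P` the set of `allowedBoxCoeffs_eighth`,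
`123674/10⁶ ≤ sInf P ≤ 1/8 ≤ sSup P ≤ 127625/10⁶`. [folklore] -/
theorem allowedBoxCoeffs_eighth_bounds :
    (123674 / 1000000 : ℝ) ≤ sInf {q : ℝ | ∃ D : CrossingData, D.IsUnitary ∧ D.SatisfiesCrossing (1 / 8) ∧
        D.ScalarsIn (Icc (197 / 200) (20001 / 20000) ∪ Ici 2) ∧ D.SpinTwoIn ({2} ∪ Ici (2 + 1)) ∧
          D.boxCoeff (197 / 200) (20001 / 20000) = q} ∧
      sInf {q : ℝ | ∃ D : CrossingData, D.IsUnitary ∧ D.SatisfiesCrossing (1 / 8) ∧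
        D.ScalarsIn (Icc (197 / 200) (20001 / 20000) ∪ Ici 2) ∧ D.SpinTwoIn ({2} ∪ Ici (2 + 1)) ∧
          D.boxCoeff (197 / 200) (20001 / 20000) = q} ≤ 1 / 8 ∧
      (1 / 8 : ℝ) ≤ sSup {q : ℝ | ∃ D : CrossingData, D.IsUnitary ∧ D.SatisfiesCrossing (1 / 8) ∧
        D.ScalarsIn (Icc (197 / 200) (20001 / 20000) ∪ Ici 2) ∧ D.SpinTwoIn ({2} ∪ Ici (2 + 1)) ∧
          D.boxCoeff (197 / 200) (20001 / 20000) = q} ∧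
      sSup {q : ℝ | ∃ D : CrossingData, D.IsUnitary ∧ D.SatisfiesCrossing (1 / 8) ∧
        D.ScalarsIn (Icc (197 / 200) (20001 / 20000) ∪ Ici 2) ∧ D.SpinTwoIn ({2} ∪ Ici (2 + 1)) ∧
          D.boxCoeff (197 / 200) (20001 / 20000) = q} ≤ 127625 / 1000000 :=
  sInf_sSup_sandwich allowedBoxCoeffs_eighth.1 allowedBoxCoeffs_eighth.2

end Summit.CriticalPhenomena.Ising3D.Control2D
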